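import Literature.NumberTheory.Automorphic.Liu2021.Def411AsPrinted
import Mathlib.RepresentationTheory.Intertwining
import Mathlib.LinearAlgebra.TensorProduct.Tower
import Mathlib.LinearAlgebra.Dimension.Finrank
import Mathlib.Algebra.BigOperators.Finprod
import Mathlib.Algebra.Category.ModuleCat.Basic
import HarnessLib

/-!
# Liu 2021, App. D §D.1–D.2 (print pp. 125–129): «Oscillator representations of local unitary groups» (INDEX onto the
# tree) and «Setup for cohomology of Shimura varieties» (STATEMENT CARPET: (D.1) Matsushima, (D.2) Zucker, the
# `ℓ`-adic comparison, `IH^i_{ξ,ι_ℓ}(π^∞)` and its dimension) — named facts over carriers; no proofs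

[Liu2021] = Yifeng Liu, *Fourier–Jacobi cycles and arithmetic relative trace formula* (with an appendix by Chao Li and
Yihang Zhu), Cambridge J. Math. **9** (2021), no. 1, 1–147 (= arXiv:2102.11518).  SOURCES READ FOR THIS FILE: the held
PRINT text (`paper:liu2021-fourier-jacobi-cycles-arithmetic-relative-trace-formula`, page file `pNNNN` = journal page
`N`; pp. 124–130 materialised) — `(p. N)` is the journal page of the item's first line — and, as second locator, the
author's TeX source `FJcycle.tex` (md5 `6db49a74122d2cb0f224fa1b39488a0c`; §D.1 = l. 5209–5297, §D.2 = `ss:setup`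
l. 5298–5347; «l. N»).  Item numbers = print = compiled arXiv v2 (cell concordance `lit/PAGE-CONCORDANCE-Liu2021.md`).

## INDEX of §D.1 «Oscillator representations of local unitary groups» (pp. 125–128; l. 5209–5297) — ALL ALREADY TYPED
## in the tree; cited here by declaration name, NOT restated

| item (print) | page | TeX | tree declaration(s) |
|---|---|---|---|
| standing data: `F` local, `char F ≠ 2`; `E` étale `F`-algebra of rank 2; `c`, `E^−`, `E^1`; `V` hermitian of rank `n ≥ 2` | p. 125 | l. 5212 | `Literature.RepresentationTheory.Liu2021.OscillatorStandingData` (file `RepresentationTheory/Liu2021/LocalOscillatorStandingData.lean`: `σ = c`, `form`, `U = U(V)`, `normOne = E^1`, `skew = E^−`, `scalar : E^1 → U(V)`) |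
| Steps 1–3: `ε ∈ E^{−×}/Nm E^×`, `V_ε`, `Mp(V_ε)`, `ω(ε)`, `ψ_F`; `μ`, `ι_μ`, `ω(μ,ε) := ω(ε) ∘ ι_μ`; `χ`, `ω(μ,ε,χ)` = maximal quotient of `ω(μ,ε)` with central character `χ` | p. 125 | l. 5215–5221 | `Literature.RepresentationTheory.Liu2021.LocalOscillatorDatum` (file `LocalOscillatorRepresentation.lean`: `omega`, `proj`, `quot`, `IrreducibleAdmissible`), `OscillatorStandingData.datum`; the data `(ε, μ, χ, ω(μ,ε))` at a place = `Literature.NumberTheory.Automorphic.Liu2021.LemD1Data` (file `LemD1AsPrinted.lean`: `eps`, `chi`, `omega`, `datum`), global sets `MuSet` ∕ `EpsRep` ∕ `ChiSet` (same file) |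
| `χ̌(x) := χ(x / x^c)` | p. 125 | l. 5223 | local: `Literature.RepresentationTheory.Liu2021.OscillatorStandingData.check` (`check_apply`, `divConj`); global: `Literature.NumberTheory.GaloisRepresentations.HeckeCharacter.checkOfChi` (file `Liu2021/CheckOfChi.lean`) |
| Lem. D.1 (irreducible, admissible; (1) vanishing criterion; (2) contragredient; (3) iso criterion `n ≥ 3`; (4) iso criterion `n = 2`) | p. 125–126 | `le:weil_nonarch` l. 5226–5236 | `Literature.NumberTheory.Automorphic.Liu2021.LemD1_1AsPrinted`, `LemD1_2AsPrinted`, `LemD1_3AsPrinted`, `LemD1_4AsPrinted` (file `LemD1AsPrinted.lean`); indexed forms `LemD1_3AsPrintedI` (`LemD1AsPrintedIndexed.lean`), `LemD1_4AsPrintedI` (`LemD1Item4AsPrintedIndexed.lean`); + ≈ 60 `LemD1*` consequence files |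
| real place: `U(p,q)_ℝ`, `𝔲_{p,q}`, `K_{p,q}`; parameters `μ_m(z) = arg(z)^m` (`m` odd), `ε = ±i`, `χ_l(z) = z^l`; `ω^{m,±,l}_{p,q}` irreducible ([SW78]); the two cohomological `π^{1,0}_{n−1,1}`, `π^{0,1}_{n−1,1}` ([BMM16]) | p. 127 | l. 5262–5280 | `Literature.NumberTheory.Automorphic.Liu2021.LemD2.Idx` (`m`, `sgn`, `l`), `LemD2.Family` (`IrreducibleAsPrinted`), `LemD2.CohPair` (`H1_10`, `H1_01`, `AsPrinted`) (file `LemD2AsPrinted.lean`); archimedean weights `Literature.RepresentationTheory.Liu2021.ArchimedeanWeight` (`exists_odd_exponent` …) |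
| Lem. D.2 (1) (2) (3) | p. 127 | l. 5282–5290 | `Literature.NumberTheory.Automorphic.Liu2021.LemD2_1AsPrinted`, `LemD2_2AsPrinted`, `LemD2_3AsPrinted` (file `LemD2AsPrinted.lean`) |

## INDEX of §D.2 «Setup for cohomology of Shimura varieties» (pp. 128–129; l. 5298–5347) — TYPED HERE

| item (print) | page | TeX | declaration |
|---|---|---|---|
| standing data `(G, h)`, reflex field `E ⊆ ℂ`, `ξ`, `𝓛_ξ`, `H^i_{(2)}(Sh(G,h), 𝓛_ξ) := colim_K …` | p. 128 | l. 5302–5306 | structure `SecD2Data` (carriers) |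
| «which is a smooth representation of `G(𝔸^∞)`» | p. 128 | l. 5306 | `Liu2021_SecD2_H2_smooth` |
| (D.1) Matsushima formula for `L²`-cohomology | p. 128 | `eq:matsushima` l. 5307–5309 | `Liu2021_eqD1_Matsushima` |
| (D.2) `H^i_{(2)} ≃ IH^i` (theorem of Looijenga ∕ Saper–Stern, «Zucker's c.») | p. 128 | `eq:zucker` l. 5319–5321 | `Liu2021_eqD2_Zucker` |
| `ι_ℓ : ℂ ≃ ℚ_ℓ^{ac}`, `𝓛_{ξ,ι_ℓ}`, `IH^i_{ét}`, comparison isomorphism `IH^i_{ét} ≃ IH^i ⊗_{ℂ,ι_ℓ} ℚ_ℓ^{ac}` | p. 129 | l. 5329–5337 | structure `SecD2EllData` (carriers), `Liu2021_SecD2_comparison` |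
| `IH^i_{ξ,ι_ℓ}(π^∞) := Hom_{ℚ_ℓ^{ac}[G(𝔸^∞)]}(ι ∘ π^∞, IH^i_{ét}(Sh(G,h), 𝓛_{ξ,ι_ℓ}))` | p. 129 | l. 5338–5342 | `iotaPi` (REAL «`ι ∘ π^∞`»), `IHpi` (REAL) |
| «which is a finite dimensional representation of `Gal(ℂ/E)`, whose dimension is equal to `Σ_{π_∞} m_disc(π_∞ ⊗ π^∞) dim_ℂ H^i(𝔤, K_G; ξ_∞ ⊗ π_∞)`» | p. 129 | l. 5343–5347 | `Liu2021_SecD2_IHpi_galoisStable`, `Liu2021_SecD2_IHpi_finrank` |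

§D.3–D.4 (Def. D.3 – Cor. D.9, pp. 129–139) are the sibling carpet `SecD3D4CohomologyUnitaryCurves.lean` (TL-t07), which posits
its own §D.2 tokens in-file (squad ruling: no import chain); this file is the reference typing of §D.2.

## What a CARRIER is (convention of `Thm418AsPrinted.lean` / `Sec42AlbaneseUnitaryShimuraII.lean`; read there)

Mathlib and the tree do not construct Shimura varieties `Sh(G,h)_K`, their `L²`- ∕ intersection ∕ `ℓ`-adic intersection
cohomology, `(𝔤, K_G)`-cohomology of automorphic representations, or the discrete multiplicity `m_disc`.  Every such
object NAMED by the printed text is a field of the hypothesis structures `SecD2Data` ∕ `SecD2EllData` below, marked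
**⟨CARRIER⟩**, its printed definition quoted in the docstring; module-valued carriers are BUNDLED Mathlib `ModuleCat`
objects (so the file declares no instance).  Each `Liu2021_… : Prop` is a PREDICATE on such a datum — NOTHING IS ASSERTED;
a consumer takes `(h : Liu2021_X D)` for ITS OWN `D`; `∀ D, Liu2021_X D` is not Liu's statement and is not claimed.  REAL
(genuine Mathlib objects): the group `G(𝔸^∞)` as a topological group PARAMETER `G`, the reflex field `E ⊆ ℂ` as an
`IntermediateField ℚ ℂ`, `Gal(ℂ/E)` as `ℂ ≃ₐ[E] ℂ` (Liu's `Gal(ℂ/k)` = `Aut(ℂ/k)`, cf. `Thm418AsPrinted`), the coefficient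
field `ℚ_ℓ^{ac}` as a field PARAMETER `Λ` with its `ℂ`-algebra structure `ι_ℓ` (bijective: field `iota_bijective`),
«`ι ∘ π^∞`» as Mathlib's base change `Λ ⊗[ℂ] π^∞`, and the `Hom`-space `IH^i_{ξ,ι_ℓ}(π^∞)` as Mathlib's module of
intertwining maps.

ED.2 (2026-09-02, squad RETRO-AUDIT, T-ref2 n2): `Liu2021_SecD2_IHpi_finrank` now carries the finiteness of the printed sum as an
explicit `Function.support … .Finite` conjunct (so the `finsum` is the printed finite sum, never Mathlib's junk `0`); every other
statement is byte-identical to ED.1 (p847861).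

TYPER LINT: statements only — no theorem, no proof, no `sorry`/`axiom`, no `instance` or instance attribute, no
`notation`/`macro`, no attribute removed.  Non-vacuity: both structures are inhabited by one-point ∕ zero carriers over
`G := Unit`, `Λ := ℂ` (evidence file `T/LIU/TL-t03/g0/SecD1D2OscillatorSetup_full_with_nonvacuity.*.lean` in the squad
HOME, not shipped).

## References

* [Liu2021] Y. Liu, *Fourier–Jacobi cycles and arithmetic relative trace formula*, Camb. J. Math. 9 (2021) 1–147,
  arXiv:2102.11518 — App. D §D.1 (pp. 125–128), §D.2 (pp. 128–129); Def. B.1 (p. 96: `m_disc`).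
* Cited BY Liu in §D.2 (not read here, locators as printed): [BC83] Borel–Casselman, Duke Math. J. 50 (1983) §4;
  [Loo88] Looijenga, Compositio Math. 67 (1988); [SS90] Saper–Stern, Ann. of Math. 132 (1990).
-/

noncomputable section

open TensorProduct DirectSum

namespace Literature.NumberTheory.Automorphic.Liu2021.AppendixD.SecD1D2OscillatorSetup

/-! ## The data of §D.2 (p. 128, l. 5302–5327): complex side -/

/-- **Carriers for [Liu2021, App. D §D.2], complex-analytic side** (p. 128; `FJcycle.tex` l. 5302–5327), over the
PARAMETER `G` = the topological group `G(𝔸^∞)` of finite-adèlic points of the group `G` of a Shimura datum.  VERBATIM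
set-up: «Let `(G, h)` be a Shimura data with `E ⊆ ℂ` its reflex field. In particular, `G` is a reductive group over `ℚ`.
Let `ξ` be an algebraic complex representation of `G`. [Footnote 22: In this article, we only need the case where `ξ` is
the trivial representation.] Then it induces a complex local system `𝓛_ξ` on `{Sh(G, h)_K ⊗_E ℂ}`. Let
`H^i_{(2)}(Sh(G, h)_K(ℂ), 𝓛_ξ)` be the `i`-th `L²`-cohomology of the complex manifold `Sh(G, h)_K(ℂ)` with coefficients in
`𝓛_ξ`. Put `H^i_{(2)}(Sh(G, h), 𝓛_ξ) := colim_K H^i_{(2)}(Sh(G, h)_K(ℂ), 𝓛_ξ)`, which is a smooth representation of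
`G(𝔸^∞)`.»  The datum is understood FOR ONE FIXED `(G, h, ξ)`; fields marked ⟨CARRIER⟩ are posited, the others genuine.
Nothing is asserted. [cite: Liu2021, App. D §D.2 (p. 128)] -/
structure SecD2Data (G : Type) [Group G] [TopologicalSpace G] : Type 1 where
  /-- «`E ⊆ ℂ` its reflex field» (p. 128, l. 5302) — REAL: a subfield of `ℂ` (as an intermediate field over `ℚ`); only
  its automorphism group `Gal(ℂ/E) := Aut(ℂ/E) = ℂ ≃ₐ[E] ℂ` is used (p. 129). -/
  reflexField : IntermediateField ℚ ℂ
  /-- ⟨CARRIER⟩ the isomorphism classes of irreducible admissible representations `π_∞` of `G(ℝ)` (index of the sums in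
  (D.1), l. 5317, and in the dimension formula, l. 5346: «`π_∞` runs through all irreducible admissible representations
  of `G(ℝ)`»). -/
  PiInf : Type
  /-- ⟨CARRIER⟩ the isomorphism classes of irreducible admissible representations `π^∞` of `G(𝔸^∞)` («`π = π_∞ ⊗ π^∞` runs
  through isomorphism classes of irreducible admissible representations of `G(𝔸)`», l. 5317; a class of `π` = the pair
  of classes `(π_∞, π^∞)`). -/
  PiFin : Type
  /-- ⟨CARRIER⟩ a representative space of the class `π^∞` (a `ℂ`-vector space, bundled). -/
  V : PiFin → ModuleCat.{0} ℂ
  /-- ⟨CARRIER⟩ the action of `G(𝔸^∞)` on the representative of `π^∞` (irreducible admissible: tree predicates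
  `IsIrreducibleOrZero`, `IsAdmissibleRep` of `Def411AsPrinted.lean` are the vocabulary; not posited as hypotheses here). -/
  rho : ∀ p : PiFin, Representation ℂ G (V p)
  /-- ⟨CARRIER⟩ `(π_∞, π^∞) ↦ m_disc(π_∞ ⊗ π^∞)`, «the discrete multiplicity of `π` (Definition B.1)» (l. 5317; Def. B.1,
  p. 96: the multiplicity of `π` in `L²_disc(G(ℚ)\G(𝔸))`; typed over the tree's automorphic spectrum in the App. B carpet
  `AppendixB/PolesEisensteinThetaLifting.lean` (TL-t08) — a token here). -/
  mdisc : PiInf → PiFin → ℕ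
  /-- ⟨CARRIER⟩ `(i, π_∞) ↦ H^i(𝔤, K_G; ξ_∞ ⊗ π_∞)`, relative Lie algebra cohomology, «`𝔤 := Lie G_ℝ`, and `K_G` is a
  maximal connected compact subgroup of `G(ℝ)`», «`ξ_∞` is the associated `(𝔤, K_G)`-module of `ξ`» (l. 5313–5315)
  (tree vocabulary for `(𝔤,K)`-cohomology of linear real groups: `Literature.NumberTheory.Automorphic.gkCohomology`,
  file `GKCohomology.lean`; a bundled token here). -/
  gkCoh : ℕ → PiInf → ModuleCat.{0} ℂ
  /-- ⟨CARRIER⟩ `i ↦ H^i_{(2)}(Sh(G, h), 𝓛_ξ) := colim_K H^i_{(2)}(Sh(G, h)_K(ℂ), 𝓛_ξ)` (l. 5304–5306). -/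
  H2 : ℕ → ModuleCat.{0} ℂ
  /-- ⟨CARRIER⟩ the action of `G(𝔸^∞)` on `H^i_{(2)}(Sh(G,h), 𝓛_ξ)` (l. 5306). -/
  rhoH2 : ∀ i, Representation ℂ G (H2 i)
  /-- ⟨CARRIER⟩ `i ↦ IH^i(Sh(G, h), 𝓛_ξ) := colim_K IH^i(\overline{Sh}(G, h)_K ⊗_E ℂ, 𝓛_ξ)`, «the direct limit over `K` of
  the complex analytic intersection cohomology of `\overline{Sh}(G, h)_K ⊗_E ℂ`, where `\overline{Sh}(G, h)_K` is the
  Baily–Borel compactification of `Sh(G, h)_K` (over `E`)» (l. 5322–5326). -/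
  IH : ℕ → ModuleCat.{0} ℂ
  /-- ⟨CARRIER⟩ the action of `G(𝔸^∞)` on `IH^i(Sh(G,h), 𝓛_ξ)` («of `G(𝔸^∞)`-modules», l. 5321). -/
  rhoIH : ∀ i, Representation ℂ G (IH i)
  /-- ⟨CARRIER⟩ the CANONICAL map `H^i_{(2)}(Sh(G,h), 𝓛_ξ) → IH^i(Sh(G,h), 𝓛_ξ)` of (D.2) («we have a canonical isomorphism»,
  l. 5318–5321; that it IS a `G(𝔸^∞)`-equivariant isomorphism is `Liu2021_eqD2_Zucker`). -/
  zucker : ∀ i, H2 i →ₗ[ℂ] IH i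

namespace SecD2Data

variable {G : Type} [Group G] [TopologicalSpace G] (D : SecD2Data G)

/-- The multiplicity space `m_disc(π) H^i(𝔤, K_G; ξ_∞ ⊗ π_∞)` of the summand of (D.1) indexed by `π = (π_∞, π^∞)`: the
direct sum of `m_disc(π)` copies of `H^i(𝔤, K_G; ξ_∞ ⊗ π_∞)` (functions `Fin m_disc(π) → H^i(…)`; the tree's convention for
«`m · H`», cf. `Literature.RepresentationTheory.BorelWallach2000.CocompactSpectrum.summand`).
[cite: Liu2021, App. D (D.1) (p. 128)] -/
abbrev multSpace (i : ℕ) (π : D.PiInf × D.PiFin) : Type :=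
  Fin (D.mdisc π.1 π.2) → D.gkCoh i π.1

/-- **[Liu2021, §D.2, l. 5306]** (p. 128), VERBATIM: «`H^i_{(2)}(Sh(G, h), 𝓛_ξ) := colim_K …`, which is a smooth representation
of `G(𝔸^∞)`.»  TYPED with the tree's `IsSmoothRep` (every vector is fixed by an open subgroup; `Def411AsPrinted.lean`), for
every degree `i`. [cite: Liu2021, App. D §D.2 (p. 128)] -/
def Liu2021_SecD2_H2_smooth : Prop :=
  ∀ i : ℕ, IsSmoothRep (D.rhoH2 i)

/-- **[Liu2021, (D.1)] the Matsushima formula for `L²`-cohomology** (p. 128; `eq:matsushima` l. 5307–5318), VERBATIM: «By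
the Matsushima formula for `L²`-cohomology, we have an isomorphism
`H^i_{(2)}(Sh(G, h), 𝓛_ξ) ≃ ⊕_π m_disc(π) H^i(𝔤, K_G; ξ_∞ ⊗ π_∞) ⊗ π^∞` (D.1) of `G(𝔸^∞)`-modules, where • `𝔤 := Lie G_ℝ`,
and `K_G` is a maximal connected compact subgroup of `G(ℝ)`, • `ξ_∞` is the associated `(𝔤, K_G)`-module of `ξ`, and •
`π = π_∞ ⊗ π^∞` runs through isomorphism classes of irreducible admissible representations of `G(𝔸)`, where `m_disc(π)` is
the discrete multiplicity of `π` (Definition B.1). Here, we have to use [BC83, Section 4] to conclude that the continuous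
part of `L²(G(ℚ)\G(𝔸), χ)` does not contribute to the `L²`-cohomology in the case of Shimura varieties.»  TYPED in the
tree's «Matsushima shape» (`Literature/RepresentationTheory/Semisimple/MatsushimaShapeConstituents.lean`: `H ≃ ⨁_π
(F_π ⊗ M_π)` with the group acting on the left factors; there `F_π = π^∞`, `M_π = m_disc(π)·H^i(𝔤,K_G;π_∞)`): there is a
`ℂ`-linear equivalence `H^i_{(2)} ≃ ⨁_{(π_∞, π^∞)} (π^∞ ⊗_ℂ multSpace)` intertwining the action of `g ∈ G(𝔸^∞)` on
`H^i_{(2)}` with `π^∞(g) ⊗ 1` on each summand (READING: factor order `π^∞ ⊗ M` instead of the printed `M ⊗ π^∞`, to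
match the tree; harmless). [cite: Liu2021, App. D (D.1) (p. 128)] -/
def Liu2021_eqD1_Matsushima (i : ℕ) : Prop :=
  ∃ Φ : D.H2 i ≃ₗ[ℂ] (⨁ π : D.PiInf × D.PiFin, (D.V π.2 ⊗[ℂ] D.multSpace i π)),
    ∀ (g : G) (x : D.H2 i) (π : D.PiInf × D.PiFin),
      Φ (D.rhoH2 i g x) π = (D.rho π.2 g).rTensor (D.multSpace i π) (Φ x π)

/-- **[Liu2021, (D.2)] the Looijenga ∕ Saper–Stern theorem («Zucker's c.»)** (p. 128–129; `eq:zucker` l. 5318–5327) — a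
THEOREM (proved 1988∕1990; Liu's text names it after Zucker, the word is elided here), VERBATIM otherwise: «By Zucker's
[c.] (proved independently by Looijenga [Loo88] and Saper–Sturn [SS90]), we have a canonical isomorphism
`H^i_{(2)}(Sh(G, h), 𝓛_ξ) ≃ IH^i(Sh(G, h), 𝓛_ξ)` (D.2) of `G(𝔸^∞)`-modules, where
`IH^i(Sh(G, h), 𝓛_ξ) := colim_K IH^i(\overline{Sh}(G, h)_K ⊗_E ℂ, 𝓛_ξ)` is the direct limit over `K` of the complex analytic
intersection cohomology of `\overline{Sh}(G, h)_K ⊗_E ℂ`, where `\overline{Sh}(G, h)_K` is the Baily–Borel compactification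
of `Sh(G, h)_K` (over `E`).»  TYPED: the canonical map (carrier `zucker i`) is bijective and `G(𝔸^∞)`-equivariant.
[cite: Liu2021, App. D (D.2) (p. 128)] -/
def Liu2021_eqD2_Zucker (i : ℕ) : Prop :=
  Function.Bijective (D.zucker i) ∧
    ∀ (g : G) (x : D.H2 i), D.zucker i (D.rhoH2 i g x) = D.rhoIH i g (D.zucker i x)

end SecD2Data

/-! ## The data of §D.2 (p. 129, l. 5329–5347): `ℓ`-adic side -/

/-- **Carriers for [Liu2021, App. D §D.2], `ℓ`-adic side** (p. 129; l. 5329–5347), extending `SecD2Data G` by the PARAMETER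
`Λ` = the field `ℚ_ℓ^{ac}` equipped with the `ℂ`-algebra structure `ι_ℓ : ℂ → ℚ_ℓ^{ac}` (VERBATIM l. 5329: «Now let `ℓ` be a
rational prime and choose an isomorphism `ι_ℓ : ℂ ≃ ℚ_ℓ^{ac}`. Then the `ℚ_ℓ^{ac}`-local system `𝓛_ξ ⊗_{ℂ,ι_ℓ} ℚ_ℓ^{ac}`
descends to an (étale) `ℚ_ℓ^{ac}`-local system `𝓛_{ξ,ι_ℓ}` on `{Sh(G, h)_K}`.»).  `IH^i_{ét}` is a
`ℚ_ℓ^{ac}[Gal(ℂ/E) × G(𝔸^∞)]`-module (cf. §4.2 p. 50 for the analogous `H¹_{ét}`): ONE representation of the product group,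
so the two actions commute by construction.  Nothing is asserted. [cite: Liu2021, App. D §D.2 (p. 129)] -/
structure SecD2EllData (G : Type) [Group G] [TopologicalSpace G] (Λ : Type) [Field Λ] [Algebra ℂ Λ]
    extends SecD2Data G where
  /-- «an isomorphism `ι_ℓ : ℂ ≃ ℚ_ℓ^{ac}`» (l. 5329) — REAL hypothesis on the parameter: the structure map `ℂ → Λ` is
  bijective. -/
  iota_bijective : Function.Bijective (algebraMap ℂ Λ)
  /-- ⟨CARRIER⟩ `i ↦ IH^i_{ét}(Sh(G, h), 𝓛_{ξ,ι_ℓ}) := colim_K IH^i_{ét}(\overline{Sh}(G, h)_K ⊗_E ℂ, 𝓛_{ξ,ι_ℓ})` (l. 5334–5337),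
  a `ℚ_ℓ^{ac}`-vector space (bundled). -/
  IHet : ℕ → ModuleCat.{0} Λ
  /-- ⟨CARRIER⟩ the commuting actions of `Gal(ℂ/E) = ℂ ≃ₐ[E] ℂ` (by transport of structure on the étale cohomology of
  `\overline{Sh}(G,h)_K ⊗_E ℂ`) and of `G(𝔸^∞)` (Hecke) on `IH^i_{ét}`, as ONE `Λ`-linear representation of the product
  group (l. 5338–5343: `Hom_{ℚ_ℓ^{ac}[G(𝔸^∞)]}(…)` «is a finite dimensional representation of `Gal(ℂ/E)`»). -/
  rhoEt : ∀ i, Representation Λ ((ℂ ≃ₐ[toSecD2Data.reflexField] ℂ) × G) (IHet i)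
  /-- ⟨CARRIER⟩ the comparison map `IH^i(Sh(G,h), 𝓛_ξ) ⊗_{ℂ,ι_ℓ} ℚ_ℓ^{ac} → IH^i_{ét}(Sh(G,h), 𝓛_{ξ,ι_ℓ})` (l. 5330–5333: «We then
  have a comparison isomorphism `IH^i_{ét}(Sh(G, h), 𝓛_{ξ,ι_ℓ}) ≃ IH^i(Sh(G, h), 𝓛_ξ) ⊗_{ℂ,ι_ℓ} ℚ_ℓ^{ac}`»), on Mathlib's base
  change `Λ ⊗[ℂ] IH^i`; that it is a `G(𝔸^∞)`-equivariant isomorphism is `Liu2021_SecD2_comparison`. -/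
  comparison : ∀ i, Λ ⊗[ℂ] (toSecD2Data.IH i) →ₗ[Λ] IHet i

namespace SecD2EllData

variable {G : Type} [Group G] [TopologicalSpace G] {Λ : Type} [Field Λ] [Algebra ℂ Λ] (D : SecD2EllData G Λ)

/-- The `G(𝔸^∞)`-action on `IH^i_{ét}`: restriction of the product action to `1 × G(𝔸^∞)`.
[cite: Liu2021, App. D §D.2 (p. 129)] -/
abbrev rhoEtG (i : ℕ) : Representation Λ G (D.IHet i) :=
  (D.rhoEt i).comp (MonoidHom.inr (ℂ ≃ₐ[D.reflexField] ℂ) G)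

/-- The `Gal(ℂ/E)`-action on `IH^i_{ét}`: restriction of the product action to `Gal(ℂ/E) × 1`.
[cite: Liu2021, App. D §D.2 (p. 129)] -/
abbrev rhoEtGal (i : ℕ) : Representation Λ (ℂ ≃ₐ[D.reflexField] ℂ) (D.IHet i) :=
  (D.rhoEt i).comp (MonoidHom.inl (ℂ ≃ₐ[D.reflexField] ℂ) G)

/-- **[Liu2021, §D.2] the comparison isomorphism** (p. 129; l. 5330–5333), VERBATIM: «We then have a comparison isomorphism
`IH^i_{ét}(Sh(G, h), 𝓛_{ξ,ι_ℓ}) ≃ IH^i(Sh(G, h), 𝓛_ξ) ⊗_{ℂ,ι_ℓ} ℚ_ℓ^{ac}`.»  TYPED: the carrier map `comparison i` from the base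
change `Λ ⊗[ℂ] IH^i` is bijective and intertwines `1 ⊗ g` (base change of the Hecke action) with the `G(𝔸^∞)`-action on
`IH^i_{ét}` (Hecke-equivariance is implicit in the printed use, e.g. the definition of `IH^i_{ξ,ι_ℓ}(π^∞)` right after).
[cite: Liu2021, App. D §D.2 (p. 129)] -/
def Liu2021_SecD2_comparison (i : ℕ) : Prop :=
  Function.Bijective (D.comparison i) ∧
    ∀ (g : G) (x : Λ ⊗[ℂ] (D.IH i)),
      D.comparison i (((D.rhoIH i) g).baseChange Λ x) = D.rhoEtG i g (D.comparison i x)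

/-- **«`ι ∘ π^∞`»** (p. 129, l. 5340): the representation `π^∞` with scalars extended along `ι_ℓ : ℂ → ℚ_ℓ^{ac}` — REAL:
Mathlib's base change `Λ ⊗[ℂ] π^∞` with `g` acting by `1 ⊗ π^∞(g)` (`Module.End.baseChangeHom` composed with `π^∞`).
[cite: Liu2021, App. D §D.2 (p. 129)] -/
def iotaPi (p : D.PiFin) : Representation Λ G (Λ ⊗[ℂ] D.V p) :=
  (Module.End.baseChangeHom ℂ Λ (D.V p)).toMonoidHom.comp (D.rho p)

/-- **`IH^i_{ξ,ι_ℓ}(π^∞)`** (p. 129; l. 5338–5342), VERBATIM: «For an irreducible admissible representation `π^∞` of `G(𝔸^∞)`,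
put `IH^i_{ξ,ι_ℓ}(π^∞) := Hom_{ℚ_ℓ^{ac}[G(𝔸^∞)]}(ι ∘ π^∞, IH^i_{ét}(Sh(G, h), 𝓛_{ξ,ι_ℓ}))`.»  REAL over the carriers:
Mathlib's `Λ`-module of intertwining maps (`Representation.IntertwiningMap`) from `ι ∘ π^∞` to `IH^i_{ét}` with its
`G(𝔸^∞)`-action. «We suppress `ξ` in the notation if it is the trivial representation» (l. 5347): `ξ` is fixed in the datum.
[cite: Liu2021, App. D §D.2 (p. 129)] -/
abbrev IHpi (i : ℕ) (p : D.PiFin) : Type :=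
  Representation.IntertwiningMap (D.iotaPi p) (D.rhoEtG i)

/-- **[Liu2021, §D.2, l. 5343] `IH^i_{ξ,ι_ℓ}(π^∞)` «is a … representation of `Gal(ℂ/E)`»** (p. 129): post-composition with
the Galois action preserves `G(𝔸^∞)`-equivariance (the two actions on `IH^i_{ét}` commute), i.e. for every
`σ ∈ Gal(ℂ/E)` and every intertwiner `f` there is an intertwiner with underlying linear map `σ ∘ f`.  (The resulting
`Λ`-linear `Gal(ℂ/E)`-action on `IH^i_{ξ,ι_ℓ}(π^∞)` is then `σ · f := σ ∘ f`.) [cite: Liu2021, App. D §D.2 (p. 129)] -/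
def Liu2021_SecD2_IHpi_galoisStable (i : ℕ) (p : D.PiFin) : Prop :=
  ∀ (σ : ℂ ≃ₐ[D.reflexField] ℂ) (f : D.IHpi i p),
    ∃ f' : D.IHpi i p, f'.toLinearMap = (D.rhoEtGal i σ) ∘ₗ f.toLinearMap

/-- **[Liu2021, §D.2, l. 5343–5347] the dimension of `IH^i_{ξ,ι_ℓ}(π^∞)`** (p. 129), VERBATIM: «which is a finite dimensional
representation of `Gal(ℂ/E)`, whose dimension is equal to `Σ_{π_∞} m_disc(π_∞ ⊗ π^∞) dim_ℂ H^i(𝔤, K_G; ξ_∞ ⊗ π_∞)`, where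
`π_∞` runs through all irreducible admissible representations of `G(ℝ)`.»  TYPED: `IH^i_{ξ,ι_ℓ}(π^∞)` is finite-dimensional
over `Λ = ℚ_ℓ^{ac}`, only finitely many `π_∞` contribute a non-zero term `m_disc(π_∞ ⊗ π^∞) · dim_ℂ H^i(𝔤,K_G;ξ_∞ ⊗ π_∞)`
(the printed sum is a finite sum — made explicit as a `Function.support … .Finite` conjunct so that the `finsum` below is the
printed sum and never Mathlib's junk `0`), and its `Λ`-dimension is that sum. [cite: Liu2021, App. D §D.2 (p. 129)] -/
def Liu2021_SecD2_IHpi_finrank (i : ℕ) (p : D.PiFin) : Prop :=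
  FiniteDimensional Λ (D.IHpi i p) ∧
    (Function.support fun q : D.PiInf => D.mdisc q p * Module.finrank ℂ (D.gkCoh i q)).Finite ∧
    Module.finrank Λ (D.IHpi i p) = ∑ᶠ q : D.PiInf, D.mdisc q p * Module.finrank ℂ (D.gkCoh i q)

end SecD2EllData

end Literature.NumberTheory.Automorphic.Liu2021.AppendixD.SecD1D2OscillatorSetup

end
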